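import Summits.Langlands.Langlands.Theorems.IrreducibilityBySelfDualityReciprocityUpToIrreducibilityRankOneMatching
import HarnessLib

/-!
# Line `Sketch` for the crux `ReciprocityUpToIrreducibility` (item stmt-Langlands-14328), continuation c7:
# stub S-F — converse of the rank-one matching: the class `rec₁[χ ∘ det]` pins `(r.ρ, r.N)` on `ℂ¹`

Support file (closes nothing; registered stub `stub_rankOne_forall_of_hasFrobSemisimpleClass` (S-F) of
the checked skeleton `Lines/Sketch.lean`, wave N7 of continuation lead c7,
prover-line-stmt-Langlands-14328-c7-0).

Statement (`stub_rankOne_forall_of_hasFrobSemisimpleClass`): for every local Langlands datum `L` of a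
non-archimedean local field `F`, every quasi-character `χ` of `Fˣ` (ramified or not) and every
Weil–Deligne representation `r` on `ℂ¹ = Fin 1 → ℂ`, if the Frobenius-semisimplification of `r` has
class `L.recGL 1 [χ ∘ det]` (`WeilDeligneRep.HasFrobSemisimpleClass`), then `r.N = 0` and
`r.ρ(w) = χ(artin w) • id` for EVERY `w ∈ W_F`.  This is the converse of S-C
(`stub_rankOne_recGL_matching_of_forall`); together they say that in rank one, at an ARBITRARY place,
the summit's local–global clause is the identity `(r.ρ, r.N) = (χ_v ∘ artin_v, 0)`.

Proof sketch.  Unfold `HasFrobSemisimpleClass`: some Frobenius-semisimplification `r'` of `r` has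
class `L.recGL 1 [χ ∘ det]`, and `L.recGL 1 [χ ∘ det] = ⟦ofQuasiCharOn (Fin 1 → ℂ) L.hns L.artin χ⟧`
because every local Langlands correspondence is local class field theory in degree one
(`IsLocalLanglandsGL.rec_one_mk`, Harris–Taylor 2001, Thm. A (i)); so `r' ≅ (χ ∘ artin • id, 0)`
(`Quotient.exact`).  An isomorphism of Weil–Deligne representations onto `(χ ∘ artin • id, 0)` forces
`N = 0` (`N_eq_zero_of_isEquivalent_ofQuasiCharOn`: it intertwines `N` with `0` and is injective) and
`ρ(w) = χ(artin w) • id` (`ρ_eq_smul_id_of_isEquivalent_ofQuasiCharOn`: scalars are central), on ANY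
space.  Finally `r'.N = r.N` and `r.ρ w = r'.ρ w + n` with `n` nilpotent (the fields of
`IsFrobSemisimplificationOf`), and a nilpotent endomorphism of a line vanishes
(`eq_zero_of_isNilpotent_of_finrank_eq_one`: it is a nilpotent scalar), so `r.ρ w = r'.ρ w`
(`ρ_eq_of_isFrobSemisimplificationOf_of_finrank_eq_one`).

Lemmas: `eq_zero_of_isNilpotent_of_finrank_eq_one`, `N_eq_zero_of_isEquivalent_ofQuasiCharOn`,
`ρ_eq_smul_id_of_isEquivalent_ofQuasiCharOn`, `ρ_eq_of_isFrobSemisimplificationOf_of_finrank_eq_one`,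
the open form `N_eq_zero_and_forall_of_hasFrobSemisimpleClass_recGL_one`, and the registered stub
(closed form).  Tree lemmas used: `IsLocalLanglandsGL.rec_one_mk`, `SmoothIrrep.ofQuasiChar_ρ_apply`,
`WeilDeligneRep.ofQuasiCharOn_ρ_apply`, `WeilDeligneRep.ofQuasiCharOn_N`,
`Module.End.exists_eq_smul_id_of_finrank_eq_one`, `Module.End.smul_id_injective`, Mathlib
`Module.finrank_fin_fun`, `IsNilpotent.eq_zero`.  No definitions; std axioms; no named fact assumed.
-/

noncomputable section

set_option linter.dupNamespace false -- project-wide option (lakefile weak.linter.dupNamespace); `Summit.Langlands.Langlands` is the mandated namespace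

open scoped MatrixGroups Matrix NumberField Classical
open Filter IsDedekindDomain Field
open Literature.NumberTheory.Automorphic Literature.NumberTheory.GaloisRepresentations
open Literature.NumberTheory.PAdicHodge
open Summit.Langlands

namespace Summit.Langlands.Langlands.Theorems.ReciprocityUpToIrreducibility

section Local

variable {F : Type} [Field F] [ValuativeRel F] [TopologicalSpace F] [IsNonarchimedeanLocalField F]

/-- **A nilpotent endomorphism of a line vanishes.**  On a one-dimensional vector space every
endomorphism is a scalar `c • id` (`Module.End.exists_eq_smul_id_of_finrank_eq_one`); if it is
nilpotent then `c ^ m • id = 0`, so `c ^ m = 0` (`Module.End.smul_id_injective`) and `c = 0` (a field is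
reduced). [folklore] -/
theorem eq_zero_of_isNilpotent_of_finrank_eq_one {k V : Type*} [Field k] [AddCommGroup V]
    [Module k V] (h1 : Module.finrank k V = 1) {n : Module.End k V} (hn : IsNilpotent n) : n = 0 := by
  haveI : Nontrivial V := Module.nontrivial_of_finrank_eq_succ h1
  obtain ⟨c, hc⟩ := Module.End.exists_eq_smul_id_of_finrank_eq_one h1 n
  obtain ⟨m, hm⟩ := hn
  rw [hc, smul_pow, ← Module.End.one_eq_id, one_pow] at hm
  have hcm : IsNilpotent c := ⟨m, Module.End.smul_id_injective k V (by
    simp only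
    rw [← Module.End.one_eq_id, hm, zero_smul])⟩
  rw [hc, hcm.eq_zero, zero_smul]

variable {V : Type*} [AddCommGroup V] [Module ℂ V] {V' : Type*} [AddCommGroup V'] [Module ℂ V']

/-- **An isomorphism onto `(χ ∘ artin • id, 0)` kills the monodromy.**  If `r ≅ ofQuasiCharOn V' hns d χ`
(on any spaces `V`, `V'`) then `r.N = 0`: the isomorphism `e` intertwines `r.N` with the monodromy
`0` of `ofQuasiCharOn` (`WeilDeligneRep.ofQuasiCharOn_N`), i.e. `e ∘ r.N = 0`, and `e` is injective.
[cite: TateCorvallis1979, (4.1.3)] -/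
theorem N_eq_zero_of_isEquivalent_ofQuasiCharOn
    (hns : WeilGroup.exists_subgroup_le_inertia_isOpen_of_continuous (F := F)) (d : LocalArtinData F)
    {χ : QuasiChar F} {r : WeilDeligneRep F ℂ V}
    (h : r.IsEquivalent (WeilDeligneRep.ofQuasiCharOn V' hns d χ)) : r.N = 0 := by
  obtain ⟨e⟩ := h
  refine LinearMap.ext fun v => e.toLinearEquiv.injective ?_
  have hc := congr($(e.comm_N) v)
  rw [WeilDeligneRep.ofQuasiCharOn_N, LinearMap.zero_comp, LinearMap.zero_apply,
    LinearMap.comp_apply] at hc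
  rw [LinearMap.zero_apply, map_zero]
  exact hc

/-- **An isomorphism onto `(χ ∘ artin • id, 0)` pins every `ρ(w)` to the scalar `χ(artin w)`.**  If
`r ≅ ofQuasiCharOn V' hns d χ` via `e` (on any spaces `V`, `V'`), then for every `w ∈ W_F` and `v ∈ V`,
`e (r.ρ w v) = χ(artin w) • e v = e (χ(artin w) • v)` (`WeilDeligneRep.ofQuasiCharOn_ρ_apply`), and `e`
is injective: a conjugate of the central element `c • id` is `c • id`.
[cite: TateCorvallis1979, (4.1.3)] -/
theorem ρ_eq_smul_id_of_isEquivalent_ofQuasiCharOn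
    (hns : WeilGroup.exists_subgroup_le_inertia_isOpen_of_continuous (F := F)) (d : LocalArtinData F)
    {χ : QuasiChar F} {r : WeilDeligneRep F ℂ V}
    (h : r.IsEquivalent (WeilDeligneRep.ofQuasiCharOn V' hns d χ)) (w : WeilGroup F) :
    r.ρ w = ((χ (d.artin w) : ℂˣ) : ℂ) • LinearMap.id := by
  obtain ⟨e⟩ := h
  refine LinearMap.ext fun v => e.toLinearEquiv.injective ?_
  have h1 := congr($(e.toIntertwiningMap.isIntertwining' w) v)
  rw [LinearMap.comp_apply, LinearMap.comp_apply, WeilDeligneRep.ofQuasiCharOn_ρ_apply] at h1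
  rw [LinearMap.smul_apply, LinearMap.id_apply, map_smul]
  exact h1

/-- **On a line, a Frobenius-semisimplification does not move `ρ`.**  If `r'` is a
Frobenius-semisimplification of `r` on a one-dimensional complex space, then `r.ρ w = r'.ρ w` for every
`w ∈ W_F`: by definition (`IsFrobSemisimplificationOf`) `r.ρ w = r'.ρ w + n` with `n` nilpotent
(commuting with `r'.ρ w`), and `n = 0` on a line (`eq_zero_of_isNilpotent_of_finrank_eq_one`) — every
endomorphism of a line is already semisimple. [cite: TateCorvallis1979, (4.1.3)]
[cite: DeligneAntwerpII1973, §8.5–8.6] -/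
theorem ρ_eq_of_isFrobSemisimplificationOf_of_finrank_eq_one {r' r : WeilDeligneRep F ℂ V}
    (h : r'.IsFrobSemisimplificationOf r) (h1 : Module.finrank ℂ V = 1) (w : WeilGroup F) :
    r.ρ w = r'.ρ w := by
  obtain ⟨n, hn, -, hw⟩ := (h.2.2 w).2
  rw [hw, eq_zero_of_isNilpotent_of_finrank_eq_one h1 hn, add_zero]

/-- **Converse of the rank-one matching (open form).**  For every local Langlands datum `L` of `F`,
every quasi-character `χ` of `Fˣ` and every Weil–Deligne representation `r` on `ℂ¹ = Fin 1 → ℂ` whose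
Frobenius-semisimplification has class `L.recGL 1 [χ ∘ det]`: `r.N = 0` and `r.ρ(w) = χ(artin w) • id`
for every `w ∈ W_F`.  A Frobenius-semisimplification `r'` of `r` with that class is isomorphic to
`ofQuasiCharOn (Fin 1 → ℂ) L.hns L.artin χ` (`IsLocalLanglandsGL.rec_one_mk` — every local Langlands
correspondence is local class field theory in degree one — and `Quotient.exact`), hence has `N = 0` and
`ρ(w) = χ(artin w) • id` (`N_eq_zero_of_isEquivalent_ofQuasiCharOn`,
`ρ_eq_smul_id_of_isEquivalent_ofQuasiCharOn`); and `r.N = r'.N`, `r.ρ w = r'.ρ w` on the line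
(`ρ_eq_of_isFrobSemisimplificationOf_of_finrank_eq_one`, `Module.finrank_fin_fun`).
[cite: HarrisTaylorAMS2001, Thm. A (i)] [cite: TateCorvallis1979, (1.4.5) and (4.1.3)] -/
theorem N_eq_zero_and_forall_of_hasFrobSemisimpleClass_recGL_one (L : LocalLanglandsDatum F)
    {χ : QuasiChar F} {r : WeilDeligneRep F ℂ (Fin 1 → ℂ)}
    (h : r.HasFrobSemisimpleClass (L.recGL 1 (IrrClass.mk (SmoothIrrep.ofQuasiChar χ)))) :
    r.N = 0 ∧ ∀ w : WeilGroup F, r.ρ w = ((χ (L.artin.artin w) : ℂˣ) : ℂ) • LinearMap.id := by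
  obtain ⟨r', hss, hc⟩ := h
  rw [L.isLocalLanglands.rec_one_mk (SmoothIrrep.ofQuasiChar_ρ_apply χ)] at hc
  have he : r'.IsEquivalent (WeilDeligneRep.ofQuasiCharOn (Fin 1 → ℂ) L.hns L.artin χ) :=
    Quotient.exact hc
  have h1 : Module.finrank ℂ (Fin 1 → ℂ) = 1 := Module.finrank_fin_fun ℂ
  refine ⟨?_, fun w => ?_⟩
  · rw [← hss.1]
    exact N_eq_zero_of_isEquivalent_ofQuasiCharOn L.hns L.artin he
  · rw [ρ_eq_of_isFrobSemisimplificationOf_of_finrank_eq_one hss h1 w]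
    exact ρ_eq_smul_id_of_isEquivalent_ofQuasiCharOn L.hns L.artin he w

end Local

/-- **Registered stub `stub_rankOne_forall_of_hasFrobSemisimpleClass` of line `Sketch` (crux
stmt-Langlands-14328, c7 wave N7)**: closed form of
`N_eq_zero_and_forall_of_hasFrobSemisimpleClass_recGL_one`.  If a Weil–Deligne representation `r` on
`ℂ¹` has Frobenius-semisimple class `L.recGL 1 [χ ∘ det]` for a local Langlands datum `L` of `F` and a
quasi-character `χ` of `Fˣ`, then `r.N = 0` and `r.ρ(w) = χ(artin w) • id` for every `w ∈ W_F`: a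
Frobenius-semisimplification `r'` of `r` (same `N`; `r.ρ w = r'.ρ w +` nilpotent, and a nilpotent
endomorphism of a line is `0`) is isomorphic to `ofQuasiCharOn (Fin 1 → ℂ) L.hns L.artin χ`
(`IsLocalLanglandsGL.rec_one_mk`, `Quotient.exact`), and an isomorphism onto `(χ ∘ artin • id, 0)`
preserves `N = 0` and the scalar by which each `w` acts. [cite: HarrisTaylorAMS2001, Thm. A (i)]
[cite: TateCorvallis1979, (4.1.3)] -/
theorem stub_rankOne_forall_of_hasFrobSemisimpleClass :
    ∀ (F : Type) [Field F] [ValuativeRel F] [TopologicalSpace F] [IsNonarchimedeanLocalField F]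
      (L : LocalLanglandsDatum F) (χ : QuasiChar F) (r : WeilDeligneRep F ℂ (Fin 1 → ℂ)),
      r.HasFrobSemisimpleClass (L.recGL 1 (IrrClass.mk (SmoothIrrep.ofQuasiChar χ))) →
      r.N = 0 ∧ ∀ w : WeilGroup F, r.ρ w = ((χ (L.artin.artin w) : ℂˣ) : ℂ) • LinearMap.id :=
  fun _ _ _ _ _ L _ _ h => N_eq_zero_and_forall_of_hasFrobSemisimpleClass_recGL_one L h

end Summit.Langlands.Langlands.Theorems.ReciprocityUpToIrreducibility

end
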